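import Mathlib
import Literature.Analysis.FluidPDE.VectorCalculus
import Literature.Analysis.FluidPDE.TaoAveragedNondegeneracy
import Summits.NavierStokesRegularity.NavierStokesRegularity.Theorems.FilamentSkeletonRssSkeletonEquilibriumLineBiotSavart

/-!
# Straight filaments of a relative equilibrium are vertical; the `K ≤ 0` slices of the s1 stubs
(helper for the registered stubs `stub_kelvinSonicVerticality` and `stub_lengthRegular` of crux
`FilamentSkeletonRss.SkeletonEquilibrium`, stmt-NavierStokesRegularity-15400; negation line
`kelvin-sonic-negation`, whose model configuration is exactly the straight vertical skeleton)

Setting of the crux: `N` unit-speed `C²` filaments `Ξ k` with the curvature clause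
`‖Ξ k″(τ)‖ √Γ ≤ K`, in relative equilibrium of the regularised Biot–Savart law in the rotating Leray
frame, `u_skel(Ξ j τ) + ½ Ξ j τ − α e₃ × Ξ j τ = w j τ • Ξ j′ τ`.

Results (sorry-free, no numerics):
* `straight_of_curvature_clause` — for `K ≤ 0 < Γ` the curvature clause forces every filament to be a
  straight line `Ξ τ = Ξ 0 + τ • Ξ′ 0` (elementary calculus);
* `norm_lineBiotSavart_le_one` — the regularised Biot–Savart field of a unit-speed straight line has norm
  `2d/(d² + 1) ≤ 1` everywhere (`d` = distance to the line; closed form `Sketch.stub_lineBiotSavart`), whence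
  `norm_skeletonVelocity_le_of_straight`: a straight skeleton induces `‖u_skel‖ ≤ Σ_k |Γ γ_k / 4π|`
  EVERYWHERE — the a-priori velocity bound that is missing for curved skeletons;
* `cross_e3_eq_zero_of_straight_equilibrium` — **RIGIDITY**: a straight filament `P + τ e` of a relative
  equilibrium with `α ≠ 0` whose induced velocity is bounded along it is VERTICAL, `e₃ × e = 0` (pair the
  tangency relation with `e₃ × e`: `α τ ‖e₃ × e‖²` is bounded in `τ`);
* `vertical_lines_of_nonposK` — hence for `K ≤ 0` every witness of the crux's clauses is a configuration
  of vertical straight lines;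
* the registered statements of `stub_kelvinSonicVerticality` and `stub_lengthRegular` with exactly ONE
  extra hypothesis `K ≤ 0` inserted after the constants' sign hypotheses:
  `kelvinSonicVerticality_of_nonposK` (conclusion with room to spare: `‖Ξ k′ × e₃‖ = 0 ≤ θ` for ALL `k, τ`,
  `Γ₁ = 1`) and `lengthRegular_of_nonposK` (`C₀ = 2`, a chord of a ball).

What this isolates: the s1 line's verticality mechanism is exact in the straight (`K ≤ 0`) class by a
two-line pairing argument that uses only boundedness of the induced velocity along the filament; for
`K > 0` the same pairing gives `|α| |τ| ‖e₃ × Ξ′‖²`-type growth only up to the curvature scale `√Γ/K`,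
and the missing input is the a-priori velocity bound (which for curved skeletons needs length-regularity,
cf. `…LengthRegularOuter`). No summit statement is proved; NS regularity is not touched.
-/

noncomputable section

open Set Filter Topology MeasureTheory
open Literature.Analysis.FluidPDE Literature.Analysis.FluidPDE.Tao2016
open scoped RealInnerProductSpace InnerProductSpace

namespace Summit.NavierStokesRegularity.NavierStokesRegularity.Theorems.SkeletonEquilibrium.StraightFilament
set_option linter.dupNamespace false

/-! ## Elementary vector algebra -/

/-- `‖v × w‖ ≤ ‖v‖ ‖w‖` (from the Literature identity `norm_cross`). [folklore] -/
private theorem norm_cross_le (v w : EuclideanSpace ℝ (Fin 3)) : ‖cross v w‖ ≤ ‖v‖ * ‖w‖ := by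
  rw [norm_cross]
  exact mul_le_of_le_one_right (mul_nonneg (norm_nonneg _) (norm_nonneg _)) (Real.sin_le_one _)

/-- `v × w = −(w × v)`. [folklore] -/
private theorem cross_swap (v w : EuclideanSpace ℝ (Fin 3)) : cross v w = -cross w v := by
  ext i
  fin_cases i <;> simp [cross_apply_zero, cross_apply_one, cross_apply_two] <;> ring

/-- `‖e₃‖ = 1`. [folklore] -/
private theorem norm_e3 : ‖(EuclideanSpace.single (2 : Fin 3) (1 : ℝ))‖ = 1 := by simp

/-! ## Straightness from the curvature clause with `K ≤ 0` -/

/-- For `0 < Γ` and `K ≤ 0` the curvature clause `‖Ξ″(τ)‖ √Γ ≤ K` forces `Ξ″ ≡ 0`. [folklore] -/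
theorem iteratedDeriv_two_eq_zero_of_nonposK {Ξ : ℝ → EuclideanSpace ℝ (Fin 3)} {Γ K : ℝ}
    (hΓ : 0 < Γ) (hK : K ≤ 0) (hκ : ∀ τ, ‖iteratedDeriv 2 Ξ τ‖ * Real.sqrt Γ ≤ K) (τ : ℝ) :
    iteratedDeriv 2 Ξ τ = 0 := by
  have hsq : 0 < Real.sqrt Γ := Real.sqrt_pos.2 hΓ
  have h1 : ‖iteratedDeriv 2 Ξ τ‖ * Real.sqrt Γ ≤ 0 := le_trans (hκ τ) hK
  have h2 : ‖iteratedDeriv 2 Ξ τ‖ * Real.sqrt Γ = 0 :=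
    le_antisymm h1 (mul_nonneg (norm_nonneg _) hsq.le)
  rcases mul_eq_zero.1 h2 with h | h
  · exact norm_eq_zero.1 h
  · exact absurd h hsq.ne'

/-- A `C²` curve with `Ξ″ ≡ 0` is the straight line `Ξ τ = Ξ 0 + τ • Ξ′ 0`, with constant velocity
`Ξ′ τ = Ξ′ 0`. [folklore] -/
theorem affine_of_iteratedDeriv_two_eq_zero {Ξ : ℝ → EuclideanSpace ℝ (Fin 3)} (hC2 : ContDiff ℝ 2 Ξ)
    (h0 : ∀ τ, iteratedDeriv 2 Ξ τ = 0) :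
    (∀ τ, deriv Ξ τ = deriv Ξ 0) ∧ (∀ τ, Ξ τ = Ξ 0 + τ • deriv Ξ 0) := by
  have hd1 : Differentiable ℝ (deriv Ξ) := by
    have h := hC2.differentiable_iteratedDeriv 1 (by norm_num)
    rwa [iteratedDeriv_one] at h
  have hd0 : Differentiable ℝ Ξ := hC2.differentiable (by norm_num)
  have hdd : ∀ τ, deriv (deriv Ξ) τ = 0 := by
    intro τ
    have h := h0 τ
    rwa [iteratedDeriv_succ, iteratedDeriv_one] at h
  have hconst : ∀ τ, deriv Ξ τ = deriv Ξ 0 := fun τ => is_const_of_deriv_eq_zero hd1 hdd τ 0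
  refine ⟨hconst, ?_⟩
  -- `g τ = Ξ τ - τ • Ξ′ 0` has zero derivative
  have hg : Differentiable ℝ (fun τ => Ξ τ - τ • deriv Ξ 0) :=
    hd0.sub (differentiable_id.smul_const _)
  have hg' : ∀ τ, deriv (fun τ => Ξ τ - τ • deriv Ξ 0) τ = 0 := by
    intro τ
    have h1 : HasDerivAt (fun τ : ℝ => τ • deriv Ξ 0) ((1 : ℝ) • deriv Ξ 0) τ :=
      (hasDerivAt_id τ).smul_const _
    have h2 : HasDerivAt Ξ (deriv Ξ τ) τ := (hd0 τ).hasDerivAt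
    have h3 : HasDerivAt (fun τ => Ξ τ - τ • deriv Ξ 0) (deriv Ξ τ - (1 : ℝ) • deriv Ξ 0) τ :=
      h2.sub h1
    rw [h3.deriv, hconst τ, one_smul, sub_self]
  intro τ
  have h := is_const_of_deriv_eq_zero hg hg' τ 0
  simp only [zero_smul, sub_zero] at h
  rw [← h]; abel

/-- **Straightness.** Under the crux's clauses for one filament (`C²`, curvature clause) with `K ≤ 0 < Γ`,
the filament is the straight line `Ξ τ = Ξ 0 + τ • Ξ′ 0` with constant unit velocity. [folklore] -/
theorem straight_of_curvature_clause {Ξ : ℝ → EuclideanSpace ℝ (Fin 3)} {Γ K : ℝ} (hC2 : ContDiff ℝ 2 Ξ)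
    (hΓ : 0 < Γ) (hK : K ≤ 0) (hκ : ∀ τ, ‖iteratedDeriv 2 Ξ τ‖ * Real.sqrt Γ ≤ K) :
    (∀ τ, deriv Ξ τ = deriv Ξ 0) ∧ (∀ τ, Ξ τ = Ξ 0 + τ • deriv Ξ 0) :=
  affine_of_iteratedDeriv_two_eq_zero hC2 (iteratedDeriv_two_eq_zero_of_nonposK hΓ hK hκ)

/-! ## The induced velocity of a straight skeleton is bounded everywhere -/

/-- **`‖u_line‖ ≤ 1`.** The regularised (core `1`) Biot–Savart field of the unit-speed straight line
`σ ↦ P + σ • e` at any point `x` has norm `2d/(d² + 1) ≤ 1`, `d` the distance from `x` to the line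
(closed form `Sketch.stub_lineBiotSavart` and `‖e × v‖² = ‖v‖² − ⟪v, e⟫² = d²`). [folklore] -/
theorem norm_lineBiotSavart_le_one (P e x : EuclideanSpace ℝ (Fin 3)) (he : ‖e‖ = 1) :
    ‖∫ σ : ℝ, ((‖x - (P + σ • e)‖ ^ 2 + 1) ^ (3 / 2 : ℝ))⁻¹ • cross e (x - (P + σ • e))‖ ≤ 1 := by
  obtain ⟨-, hform⟩ := Sketch.stub_lineBiotSavart P e x he
  rw [hform]
  set v := x - P with hv
  set c := ‖cross e v‖ with hc
  have hc0 : 0 ≤ c := norm_nonneg _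
  have hcsq : c ^ 2 = ‖v‖ ^ 2 - (inner ℝ v e) ^ 2 := by
    rw [hc, norm_cross_sq, he, real_inner_comm e v]; ring
  have hA : ‖v‖ ^ 2 - (inner ℝ v e) ^ 2 + 1 = c ^ 2 + 1 := by rw [hcsq]
  have hA0 : 0 < c ^ 2 + 1 := by positivity
  rw [hA, norm_smul, Real.norm_eq_abs, abs_of_pos (by positivity : (0 : ℝ) < 2 / (c ^ 2 + 1)), ← hc,
    div_mul_eq_mul_div, div_le_one hA0]
  nlinarith [sq_nonneg (c - 1)]

/-- The same bound for a filament KNOWN to be the straight line `Ξ σ = P + σ • e`, `Ξ′ ≡ e`, in the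
crux's integrand shape. [folklore] -/
theorem norm_filamentBiotSavart_le_one {Ξ : ℝ → EuclideanSpace ℝ (Fin 3)} {P e : EuclideanSpace ℝ (Fin 3)}
    (he : ‖e‖ = 1) (hline : ∀ σ, Ξ σ = P + σ • e) (hder : ∀ σ, deriv Ξ σ = e)
    (x : EuclideanSpace ℝ (Fin 3)) :
    ‖∫ σ : ℝ, ((‖x - Ξ σ‖ ^ 2 + 1) ^ (3 / 2 : ℝ))⁻¹ • cross (deriv Ξ σ) (x - Ξ σ)‖ ≤ 1 := by
  simp_rw [hder, hline]
  exact norm_lineBiotSavart_le_one P e x he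

/-- **A-priori velocity bound for straight skeletons.** If every filament is a unit-speed straight line,
the skeleton's regularised Biot–Savart velocity is bounded EVERYWHERE by `Σ_k |Γ γ_k / 4π|`. [folklore] -/
theorem norm_skeletonVelocity_le_of_straight {N : ℕ} (Γ : ℝ) (γ : Fin N → ℝ)
    {Ξ : Fin N → ℝ → EuclideanSpace ℝ (Fin 3)} (P e : Fin N → EuclideanSpace ℝ (Fin 3))
    (he : ∀ k, ‖e k‖ = 1) (hline : ∀ k σ, Ξ k σ = P k + σ • e k) (hder : ∀ k σ, deriv (Ξ k) σ = e k)
    (x : EuclideanSpace ℝ (Fin 3)) :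
    ‖∑ k : Fin N, (Γ * γ k / (4 * Real.pi)) • ∫ σ : ℝ,
        ((‖x - Ξ k σ‖ ^ 2 + 1) ^ (3 / 2 : ℝ))⁻¹ • cross (deriv (Ξ k) σ) (x - Ξ k σ)‖
      ≤ ∑ k : Fin N, |Γ * γ k / (4 * Real.pi)| := by
  refine (norm_sum_le _ _).trans (Finset.sum_le_sum fun k _ => ?_)
  rw [norm_smul, Real.norm_eq_abs]
  have h := norm_filamentBiotSavart_le_one (he k) (hline k) (hder k) x
  have ha : 0 ≤ |Γ * γ k / (4 * Real.pi)| := abs_nonneg _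
  calc |Γ * γ k / (4 * Real.pi)| * ‖∫ σ : ℝ, ((‖x - Ξ k σ‖ ^ 2 + 1) ^ (3 / 2 : ℝ))⁻¹ •
          cross (deriv (Ξ k) σ) (x - Ξ k σ)‖
        ≤ |Γ * γ k / (4 * Real.pi)| * 1 := mul_le_mul_of_nonneg_left h ha
    _ = |Γ * γ k / (4 * Real.pi)| := mul_one _

/-! ## Rigidity: straight equilibrium filaments are vertical -/

/-- **Rigidity of straight equilibrium filaments.** Let the straight unit-speed line `τ ↦ P + τ • e` satisfy
the tangency relation of the rotating Leray frame, `u τ + ½ (P + τ e) − α e₃ × (P + τ e) = w τ • e`, with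
`α ≠ 0` and an induced velocity bounded along the line, `‖u τ‖ ≤ M`. Then the line is VERTICAL:
`e₃ × e = 0`. Proof: pairing with `f = e₃ × e ⊥ e` gives `α τ ‖f‖² = ⟪u τ, f⟫ + ½⟪P, f⟫ − α⟪e₃ × P, f⟫`,
bounded in `τ`. [folklore] -/
theorem cross_e3_eq_zero_of_straight_equilibrium {P e : EuclideanSpace ℝ (Fin 3)}
    {u : ℝ → EuclideanSpace ℝ (Fin 3)} {w : ℝ → ℝ} {α M : ℝ} (hα : α ≠ 0) (hu : ∀ τ, ‖u τ‖ ≤ M)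
    (heq : ∀ τ, u τ + (1 / 2 : ℝ) • (P + τ • e)
      - α • cross (EuclideanSpace.single (2 : Fin 3) (1 : ℝ)) (P + τ • e) = w τ • e) :
    cross (EuclideanSpace.single (2 : Fin 3) (1 : ℝ)) e = 0 := by
  set e₃ : EuclideanSpace ℝ (Fin 3) := EuclideanSpace.single (2 : Fin 3) (1 : ℝ) with he₃
  set f := cross e₃ e with hf
  have hfe : ⟪e, f⟫ = 0 := inner_self_cross_right e₃ e
  have hff : ⟪f, f⟫ = ‖f‖ ^ 2 := real_inner_self_eq_norm_sq f
  -- the pairing identity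
  have key : ∀ τ, α * τ * ‖f‖ ^ 2 = ⟪u τ, f⟫ + 1 / 2 * ⟪P, f⟫ - α * ⟪cross e₃ P, f⟫ := by
    intro τ
    have h := congrArg (fun v => ⟪v, f⟫) (heq τ)
    simp only [smul_add, cross_add_right, cross_smul_right, inner_add_left, inner_sub_left,
      real_inner_smul_left, hfe, mul_zero, add_zero] at h
    rw [← hf, hff] at h
    linarith
  -- the right-hand side is bounded
  set B := M * ‖f‖ + 1 / 2 * (‖P‖ * ‖f‖) + |α| * (‖cross e₃ P‖ * ‖f‖) with hB
  have hbound : ∀ τ, α * τ * ‖f‖ ^ 2 ≤ B := by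
    intro τ
    rw [key τ, hB]
    have h1 : ⟪u τ, f⟫ ≤ M * ‖f‖ :=
      (real_inner_le_norm _ _).trans (mul_le_mul_of_nonneg_right (hu τ) (norm_nonneg _))
    have h2 : ⟪P, f⟫ ≤ ‖P‖ * ‖f‖ := real_inner_le_norm _ _
    have h3 : -(α * ⟪cross e₃ P, f⟫) ≤ |α| * (‖cross e₃ P‖ * ‖f‖) := by
      have h31 : -(α * ⟪cross e₃ P, f⟫) ≤ |α * ⟪cross e₃ P, f⟫| := neg_le_abs _
      rw [abs_mul] at h31
      exact h31.trans (mul_le_mul_of_nonneg_left (abs_real_inner_le_norm _ _) (abs_nonneg _))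
    linarith
  -- if `f ≠ 0`, choose `τ` with `α τ ‖f‖² = B + 1`
  by_contra hne
  have hfpos : 0 < ‖f‖ ^ 2 := by
    have : 0 < ‖f‖ := norm_pos_iff.2 hne
    positivity
  have hden : α * ‖f‖ ^ 2 ≠ 0 := mul_ne_zero hα hfpos.ne'
  have h := hbound ((B + 1) / (α * ‖f‖ ^ 2))
  have hval : α * ((B + 1) / (α * ‖f‖ ^ 2)) * ‖f‖ ^ 2 = B + 1 := by
    field_simp
  linarith

/-! ## The `K ≤ 0` class of the crux: vertical straight lines -/

/-- **Every `K ≤ 0` witness of the crux's clauses is a configuration of vertical straight lines.** For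
`K ≤ 0`, `1 ≤ Γ`, `α ≠ 0`, the per-filament clauses and the relative-equilibrium relation force
`Ξ k τ = Ξ k 0 + τ • e_k` with `‖e_k‖ = 1` and `e₃ × e_k = 0` for every `k` (the separation and
integrability clauses are idle). [folklore] -/
theorem vertical_lines_of_nonposK {N : ℕ} {γ : Fin N → ℝ} {α K Γ : ℝ} (hα : α ≠ 0) (hK : K ≤ 0)
    (hΓ : 1 ≤ Γ) {Ξ : Fin N → ℝ → EuclideanSpace ℝ (Fin 3)} {w : Fin N → ℝ → ℝ}
    (hcl : ∀ j, ContDiff ℝ 2 (Ξ j) ∧ Function.Injective (Ξ j) ∧ Differentiable ℝ (w j) ∧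
      (∀ τ, ‖deriv (Ξ j) τ‖ = 1) ∧ (∀ τ, ‖iteratedDeriv 2 (Ξ j) τ‖ * Real.sqrt Γ ≤ K) ∧
      Tendsto (fun τ => ‖Ξ j τ‖) atTop atTop ∧ Tendsto (fun τ => ‖Ξ j τ‖) atBot atTop)
    (heq : ∀ j τ, (∑ k : Fin N, (Γ * γ k / (4 * Real.pi)) • ∫ σ : ℝ,
        ((‖Ξ j τ - Ξ k σ‖ ^ 2 + 1) ^ (3 / 2 : ℝ))⁻¹ • cross (deriv (Ξ k) σ) (Ξ j τ - Ξ k σ))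
        + (1 / 2 : ℝ) • Ξ j τ - α • cross (EuclideanSpace.single (2 : Fin 3) (1 : ℝ)) (Ξ j τ)
        = w j τ • deriv (Ξ j) τ) :
    ∀ k, (∀ τ, deriv (Ξ k) τ = deriv (Ξ k) 0) ∧ (∀ τ, Ξ k τ = Ξ k 0 + τ • deriv (Ξ k) 0) ∧
      ‖deriv (Ξ k) 0‖ = 1 ∧ cross (EuclideanSpace.single (2 : Fin 3) (1 : ℝ)) (deriv (Ξ k) 0) = 0 := by
  have hΓ0 : 0 < Γ := by linarith
  -- all filaments are straight
  have hstr : ∀ k, (∀ τ, deriv (Ξ k) τ = deriv (Ξ k) 0) ∧ (∀ τ, Ξ k τ = Ξ k 0 + τ • deriv (Ξ k) 0) :=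
    fun k => straight_of_curvature_clause (hcl k).1 hΓ0 hK (hcl k).2.2.2.2.1
  have he : ∀ k, ‖deriv (Ξ k) 0‖ = 1 := fun k => (hcl k).2.2.2.1 0
  intro k
  refine ⟨(hstr k).1, (hstr k).2, he k, ?_⟩
  -- the induced velocity along filament `k` is bounded, and the tangency relation has the line shape
  refine cross_e3_eq_zero_of_straight_equilibrium (P := Ξ k 0) (w := w k) (M := ∑ k' : Fin N,
    |Γ * γ k' / (4 * Real.pi)|) hα
    (u := fun τ => ∑ k' : Fin N, (Γ * γ k' / (4 * Real.pi)) • ∫ σ : ℝ,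
        ((‖Ξ k τ - Ξ k' σ‖ ^ 2 + 1) ^ (3 / 2 : ℝ))⁻¹ • cross (deriv (Ξ k') σ) (Ξ k τ - Ξ k' σ))
    (fun τ => norm_skeletonVelocity_le_of_straight Γ γ (fun k' => Ξ k' 0) (fun k' => deriv (Ξ k') 0)
      he (fun k' σ => (hstr k').2 σ) (fun k' σ => (hstr k').1 σ) (Ξ k τ)) ?_
  intro τ
  have h := heq k τ
  rw [(hstr k).1 τ] at h
  rw [← (hstr k).2 τ]
  exact h

/-! ## The registered stubs, `K ≤ 0` slices -/

/-- Chord of a ball: the parameters at which the unit-speed straight line `P + τ • e` lies in the closed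
ball `B(x, D)` form a set of Lebesgue measure `≤ 2D`. [folklore] -/
theorem volume_line_inter_ball_le (P e x : EuclideanSpace ℝ (Fin 3)) (he : ‖e‖ = 1) (D : ℝ) :
    volume {τ : ℝ | ‖P + τ • e - x‖ ≤ D} ≤ ENNReal.ofReal (2 * D) := by
  set s₀ := ⟪x - P, e⟫ with hs₀
  have hsub : {τ : ℝ | ‖P + τ • e - x‖ ≤ D} ⊆ Icc (s₀ - D) (s₀ + D) := by
    intro τ hτ
    have h1 : ⟪P + τ • e - x, e⟫ = τ - s₀ := by
      rw [hs₀, inner_sub_left, inner_add_left, real_inner_smul_left, real_inner_self_eq_norm_sq, he,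
        inner_sub_left]
      ring
    have h2 : |⟪P + τ • e - x, e⟫| ≤ ‖P + τ • e - x‖ * ‖e‖ := abs_real_inner_le_norm _ _
    rw [h1, he, mul_one] at h2
    have h3 : |τ - s₀| ≤ D := h2.trans hτ
    rw [abs_le] at h3
    exact ⟨by linarith [h3.1], by linarith [h3.2]⟩
  calc volume {τ : ℝ | ‖P + τ • e - x‖ ≤ D} ≤ volume (Icc (s₀ - D) (s₀ + D)) := measure_mono hsub
    _ = ENNReal.ofReal (2 * D) := by rw [Real.volume_Icc]; ring_nf

/-- **`stub_lengthRegular`, `K ≤ 0` slice.** The registered statement of `stub_lengthRegular` with the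
single extra hypothesis `K ≤ 0` (inserted after `0 < ρ`): then every filament is a straight line and
`C₀ = 2` works (a chord of a ball; the equilibrium relation is not even needed). [folklore] -/
theorem lengthRegular_of_nonposK :
    ∀ (N : ℕ) (γ : Fin N → ℝ) (α ρ K : ℝ), α ≠ 0 → 0 < ρ → K ≤ 0 →
      ∃ C₀ : ℝ, 0 < C₀ ∧ ∀ Γ : ℝ, 1 ≤ Γ →
        ∀ (Ξ : Fin N → ℝ → EuclideanSpace ℝ (Fin 3)) (w : Fin N → ℝ → ℝ),
          (∀ j, ContDiff ℝ 2 (Ξ j) ∧ Function.Injective (Ξ j) ∧ Differentiable ℝ (w j) ∧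
              (∀ τ, ‖deriv (Ξ j) τ‖ = 1) ∧ (∀ τ, ‖iteratedDeriv 2 (Ξ j) τ‖ * Real.sqrt Γ ≤ K) ∧
              Tendsto (fun τ => ‖Ξ j τ‖) atTop atTop ∧ Tendsto (fun τ => ‖Ξ j τ‖) atBot atTop) →
          (∀ j k, j ≠ k → ∀ τ σ, ρ * Real.sqrt Γ ≤ ‖Ξ j τ - Ξ k σ‖) →
          (∀ j (x : EuclideanSpace ℝ (Fin 3)), Integrable (fun σ : ℝ =>
              ((‖x - Ξ j σ‖ ^ 2 + 1) ^ (3 / 2 : ℝ))⁻¹ • cross (deriv (Ξ j) σ) (x - Ξ j σ))) →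
          (∀ j τ, (∑ k : Fin N, (Γ * γ k / (4 * Real.pi)) • ∫ σ : ℝ,
                ((‖Ξ j τ - Ξ k σ‖ ^ 2 + 1) ^ (3 / 2 : ℝ))⁻¹ • cross (deriv (Ξ k) σ) (Ξ j τ - Ξ k σ))
              + (1 / 2 : ℝ) • Ξ j τ - α • cross (EuclideanSpace.single (2 : Fin 3) (1 : ℝ)) (Ξ j τ)
              = w j τ • deriv (Ξ j) τ) →
          ∀ (k : Fin N) (x : EuclideanSpace ℝ (Fin 3)) (D : ℝ), Real.sqrt Γ ≤ D →
            volume {τ : ℝ | ‖Ξ k τ - x‖ ≤ D} ≤ ENNReal.ofReal (C₀ * D) := by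
  intro N γ α ρ K _ _ hK
  refine ⟨2, by norm_num, ?_⟩
  intro Γ hΓ Ξ w hcl _ _ _ k x D _
  have hΓ0 : 0 < Γ := by linarith
  obtain ⟨-, hline⟩ := straight_of_curvature_clause (hcl k).1 hΓ0 hK (hcl k).2.2.2.2.1
  have he : ‖deriv (Ξ k) 0‖ = 1 := (hcl k).2.2.2.1 0
  have hset : {τ : ℝ | ‖Ξ k τ - x‖ ≤ D} = {τ : ℝ | ‖Ξ k 0 + τ • deriv (Ξ k) 0 - x‖ ≤ D} := by
    ext τ; simp only [mem_setOf_eq, ← hline τ]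
  rw [hset]
  exact volume_line_inter_ball_le (Ξ k 0) (deriv (Ξ k) 0) x he D

/-- **`stub_kelvinSonicVerticality`, `K ≤ 0` slice.** The registered statement of
`stub_kelvinSonicVerticality` with the single extra hypothesis `K ≤ 0` (inserted after `0 < C₀`): then
every witness is a configuration of VERTICAL straight lines (`vertical_lines_of_nonposK`), so the
conclusion holds with room to spare — `‖Ξ k′(τ) × e₃‖ = 0 ≤ θ` for all `k, τ`, with `Γ₁ = 1`; the
separation, integrability, length-regularity and stagnation hypotheses are idle. [folklore] -/
theorem kelvinSonicVerticality_of_nonposK :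
    ∀ (N : ℕ) (γ : Fin N → ℝ) (α ρ K C₀ : ℝ), α ≠ 0 → 0 < ρ → 0 < C₀ → K ≤ 0 →
      ∀ θ : ℝ, 0 < θ → ∀ R : ℝ, 1 ≤ R → ∃ Γ₁ : ℝ, ∀ Γ : ℝ, Γ₁ ≤ Γ → 1 ≤ Γ →
        ∀ (Ξ : Fin N → ℝ → EuclideanSpace ℝ (Fin 3)) (w : Fin N → ℝ → ℝ),
          (∀ j, ContDiff ℝ 2 (Ξ j) ∧ Function.Injective (Ξ j) ∧ Differentiable ℝ (w j) ∧
              (∀ τ, ‖deriv (Ξ j) τ‖ = 1) ∧ (∀ τ, ‖iteratedDeriv 2 (Ξ j) τ‖ * Real.sqrt Γ ≤ K) ∧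
              Tendsto (fun τ => ‖Ξ j τ‖) atTop atTop ∧ Tendsto (fun τ => ‖Ξ j τ‖) atBot atTop) →
          (∀ j k, j ≠ k → ∀ τ σ, ρ * Real.sqrt Γ ≤ ‖Ξ j τ - Ξ k σ‖) →
          (∀ j (x : EuclideanSpace ℝ (Fin 3)), Integrable (fun σ : ℝ =>
              ((‖x - Ξ j σ‖ ^ 2 + 1) ^ (3 / 2 : ℝ))⁻¹ • cross (deriv (Ξ j) σ) (x - Ξ j σ))) →
          (∀ j τ, (∑ k : Fin N, (Γ * γ k / (4 * Real.pi)) • ∫ σ : ℝ,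
                ((‖Ξ j τ - Ξ k σ‖ ^ 2 + 1) ^ (3 / 2 : ℝ))⁻¹ • cross (deriv (Ξ k) σ) (Ξ j τ - Ξ k σ))
              + (1 / 2 : ℝ) • Ξ j τ - α • cross (EuclideanSpace.single (2 : Fin 3) (1 : ℝ)) (Ξ j τ)
              = w j τ • deriv (Ξ j) τ) →
          (∀ (k : Fin N) (x : EuclideanSpace ℝ (Fin 3)) (D : ℝ), Real.sqrt Γ ≤ D →
              volume {τ : ℝ | ‖Ξ k τ - x‖ ≤ D} ≤ ENNReal.ofReal (C₀ * D)) →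
          ∀ (j : Fin N) (τs : ℝ), w j τs = 0 → ∀ (k : Fin N) (τ : ℝ),
            ‖Ξ k τ - Ξ j τs‖ ≤ R * Real.sqrt Γ →
              ‖cross (deriv (Ξ k) τ) (EuclideanSpace.single (2 : Fin 3) (1 : ℝ))‖ ≤ θ := by
  intro N γ α ρ K C₀ hα _ _ hK θ hθ R _
  refine ⟨1, ?_⟩
  intro Γ _ hΓ Ξ w hcl _ _ heq _ j τs _ k τ _
  obtain ⟨hder, -, -, hvert⟩ := vertical_lines_of_nonposK (γ := γ) hα hK hΓ hcl heq k
  rw [hder τ, cross_swap, hvert, neg_zero, norm_zero]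
  exact hθ.le

end Summit.NavierStokesRegularity.NavierStokesRegularity.Theorems.SkeletonEquilibrium.StraightFilament
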